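import Literature.Computability.Complexity.RandomKSatWeights
import Literature.Probability.Moments.IIDSumSignProbability
import Mathlib.Analysis.Calculus.Deriv.Pow
import Mathlib.Analysis.Calculus.Deriv.Add
import Mathlib.Analysis.Calculus.Deriv.Mul
import Mathlib.Algebra.BigOperators.Field
import HarnessLib

/-!
# The balanced first moment: `E[X₊] ≥ c · E[X]` at the balancing weight (Achlioptas–Peres, Lemma 7)

Continuation of `RandomKSatWeights.lean` (AP2004 = D. Achlioptas, Y. Peres, J. Amer. Math. Soc. 17
(2004); arXiv:cs/0305009). AP Lemma 7 (p. 15): *if `γ² = 1 - ε₀` with `ε₀ (2-ε₀)^{k-1} = 1` then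
`E[X₊]/E[X] → 1/2`*. Its proof (§8, pp. 16–17) introduces, for a fixed assignment `σ`, the
TILTED clause distribution `P̃(c) ∝ γ^{H(σ,c)} 1_{σ ∈ S(c)}` (our `clauseWeight λ σ c / U`), under
which the `m` clauses are i.i.d., notes that `E[X₊]/E[X] = P̃[H(σ,F) ≥ 0]`, computes
`Ẽ[H(σ,c)] = 0` exactly at the balancing `ε₀`, and concludes by the central limit theorem. We prove
the positive-probability form that the second-moment argument actually uses —
`E[X₊] ≥ c(k,λ) · E[X]` uniformly in `n, m` — replacing the CLT by the fourth-moment bound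
`Literature.Probability.Moments.sum_prod_ite_sum_nonneg_ge`.

## Results (all proved; `λ = γ² = 1 - ε₀`, balance equation `(1+λ)^{k-1}(1-λ) = 1`)

* `hasDerivAt_sum_clauseWeight`, `sum_clauseWeight_mul_satCount` — differentiating the
  first-moment identity `Σ_c λ^s 1[s≥1] = n^k((1+λ)^k - 1)` in `λ`:
  `Σ_c clauseWeight λ σ c · s(σ,c) = k λ n^k (1+λ)^{k-1}` (AP §8: `Ẽ_γ[H(σ,c)]`);
* `sum_clauseWeight_mul_sub_eq_zero` — **tilted mean zero**: under the balance equation,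
  `Σ_c clauseWeight λ σ c · (2 s(σ,c) - k) = 0` (AP (47) and p. 16: "we see that
  `Ẽ_γ[H(σ,c) 1_{σ∈S(c)}] = 0`");
* `sum_clauseWeight_mul_sub_sq_ge` — tilted second moment from below:
  `Σ_c clauseWeight · (2s-k)² ≥ k² (nλ)^k` (the clauses all of whose literals are true);
* `sum_ite_assignmentWeight_ge` — for every `σ` and `m ≥ 1`:
  `Σ_Φ 1[2S(σ,Φ) ≥ km] W_λ(σ,Φ) ≥ c · U^m`, `U = n^k((1+λ)^k-1)`, with
  `c = v₀/(4(k²+3v₀))`, `v₀ = k² λ^k/((1+λ)^k - 1)`;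
* `exists_sum_balancedCount_ge` — **AP Lemma 7, positive form**: there is `c = c(k, λ) > 0` with
  `Σ_Φ X₊(Φ) ≥ c · Σ_Φ X(Φ)` for all `n ≥ 1` and all `m`.
-/

noncomputable section

namespace Literature.Computability.Complexity

open Finset
open scoped Classical

namespace RandomKSat

variable {n k m : ℕ}

/-! ### The tilted mean: differentiate the first-moment identity -/

/-- The first-moment identity is differentiable in `λ` termwise:
`d/dλ Σ_c λ^{s} 1[s ≥ 1] = Σ_c 1[s ≥ 1] s λ^{s-1}`. [folklore] -/
theorem hasDerivAt_sum_clauseWeight (σ : Fin n → Bool) (lam : ℝ) :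
    HasDerivAt (fun l : ℝ => ∑ c : Fin k → Fin n × Bool, clauseWeight l σ c)
      (∑ c : Fin k → Fin n × Bool,
        if satCount σ c = 0 then 0 else (satCount σ c : ℝ) * lam ^ (satCount σ c - 1)) lam := by
  apply HasDerivAt.fun_sum
  intro c _
  unfold clauseWeight
  split_ifs with h
  · exact hasDerivAt_const lam 0
  · exact hasDerivAt_pow (satCount σ c) lam

/-- **`Σ_c clauseWeight λ σ c · s(σ, c) = k λ n^k (1+λ)^{k-1}`**: both sides are
`λ ·` the derivative of `Σ_c clauseWeight = n^k((1+λ)^k - 1)` (`sum_clauseWeight`).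
[cite: AchlioptasPeres2004, §8 p. 16 (computation of `Ẽ_γ[H(σ,c)]`)] -/
theorem sum_clauseWeight_mul_satCount (lam : ℝ) (σ : Fin n → Bool) :
    ∑ c : Fin k → Fin n × Bool, clauseWeight lam σ c * satCount σ c =
      k * lam * (n : ℝ) ^ k * (1 + lam) ^ (k - 1) := by
  -- the derivative of the right-hand side of `sum_clauseWeight`
  have h2 : HasDerivAt (fun l : ℝ => (n : ℝ) ^ k * ((1 + l) ^ k - 1))
      ((n : ℝ) ^ k * (k * (1 + lam) ^ (k - 1))) lam := by
    have h := ((hasDerivAt_id lam).const_add 1).pow k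
    simp only [mul_one] at h
    have := (h.sub_const 1).const_mul ((n : ℝ) ^ k)
    simpa using this
  have h1 := hasDerivAt_sum_clauseWeight (k := k) σ lam
  have hfun : (fun l : ℝ => ∑ c : Fin k → Fin n × Bool, clauseWeight l σ c) =
      fun l : ℝ => (n : ℝ) ^ k * ((1 + l) ^ k - 1) := funext fun l => sum_clauseWeight l σ
  rw [hfun] at h1
  have heq := h1.unique h2
  -- multiply the derivative identity by `λ`
  have key : ∑ c : Fin k → Fin n × Bool, clauseWeight lam σ c * satCount σ c =
      lam * ∑ c : Fin k → Fin n × Bool,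
        (if satCount σ c = 0 then 0 else (satCount σ c : ℝ) * lam ^ (satCount σ c - 1)) := by
    rw [Finset.mul_sum]
    refine Finset.sum_congr rfl fun c _ => ?_
    unfold clauseWeight
    split_ifs with h
    · simp
    · have epow : lam ^ satCount σ c = lam ^ (satCount σ c - 1) * lam := by
        rw [← pow_succ, Nat.sub_add_cancel (Nat.pos_of_ne_zero h)]
      rw [epow]
      ring
  rw [key, heq]
  ring

/-- **Tilted mean zero** (AP p. 16): under the balance equation `(1+λ)^{k-1}(1-λ) = 1`
(i.e. `ε₀(2-ε₀)^{k-1} = 1` with `λ = 1 - ε₀`, AP (47)),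
`Σ_c clauseWeight λ σ c · (2 s(σ,c) - k) = 0`: the statistic `H = 2s - k` is centred under the
tilted clause law. [cite: AchlioptasPeres2004, eq. (47) p. 15 and §8 p. 16] -/
theorem sum_clauseWeight_mul_sub_eq_zero (hk : 1 ≤ k) {lam : ℝ}
    (hbal : (1 + lam) ^ (k - 1) * (1 - lam) = 1) (σ : Fin n → Bool) :
    ∑ c : Fin k → Fin n × Bool, clauseWeight lam σ c * (2 * (satCount σ c : ℝ) - k) = 0 := by
  have e : ∀ c : Fin k → Fin n × Bool, clauseWeight lam σ c * (2 * (satCount σ c : ℝ) - k) =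
      2 * (clauseWeight lam σ c * satCount σ c) - k * clauseWeight lam σ c := fun c => by ring
  simp only [e, Finset.sum_sub_distrib, ← Finset.mul_sum]
  rw [sum_clauseWeight_mul_satCount, sum_clauseWeight]
  have hk' : k = (k - 1) + 1 := (Nat.sub_add_cancel hk).symm
  have epow : (1 + lam) ^ k = (1 + lam) ^ (k - 1) * (1 + lam) := by
    conv_lhs => rw [hk', pow_succ]
  rw [epow]
  have : (n : ℝ) ^ k * k * (1 - (1 + lam) ^ (k - 1) * (1 - lam)) = 0 := by rw [hbal]; ring
  linear_combination this

/-- The tilted second moment from below: `Σ_c clauseWeight λ σ c · (2s - k)² ≥ k² (nλ)^k` for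
`λ ≥ 0` — the `n^k` clauses all of whose literals are true have weight `λ^k` and `H = k`.
[cite: AchlioptasPeres2004, §8 p. 16 (the tilted law is non-degenerate)] -/
theorem sum_clauseWeight_mul_sub_sq_ge {lam : ℝ} (hl : 0 ≤ lam) (σ : Fin n → Bool) :
    (k : ℝ) ^ 2 * ((n : ℝ) * lam) ^ k ≤
      ∑ c : Fin k → Fin n × Bool, clauseWeight lam σ c * (2 * (satCount σ c : ℝ) - k) ^ 2 := by
  -- compare termwise with `k² ∏_j (λ if σ ⊨ c_j else 0)`
  have hcount : ∑ c : Fin k → Fin n × Bool, ∏ j, (if σ (c j).1 = (c j).2 then lam else 0) =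
      ((n : ℝ) * lam) ^ k := by
    rw [← Fintype.sum_pow (fun ℓ : Fin n × Bool => if σ ℓ.1 = ℓ.2 then lam else 0) k,
      sum_literals_ite]
    ring
  rw [← hcount, Finset.mul_sum]
  refine Finset.sum_le_sum fun c _ => ?_
  by_cases hall : ∀ j, σ (c j).1 = (c j).2
  · -- all literals true: `s = k`, weight `λ^k`
    have hs : satCount σ c = k := by
      unfold satCount
      rw [Finset.filter_true_of_mem fun j _ => hall j, Finset.card_univ, Fintype.card_fin]
    have hprod : ∏ j, (if σ (c j).1 = (c j).2 then lam else 0) = lam ^ k := by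
      rw [Finset.prod_congr rfl fun j _ => if_pos (hall j), Finset.prod_const, Finset.card_univ,
        Fintype.card_fin]
    rw [hprod, clauseWeight, hs]
    rcases Nat.eq_zero_or_pos k with hk | hk
    · subst hk; simp
    · rw [if_neg (by omega)]
      ring_nf
      exact le_rfl
  · push Not at hall
    obtain ⟨j, hj⟩ := hall
    have hprod : ∏ j, (if σ (c j).1 = (c j).2 then lam else 0) = 0 :=
      Finset.prod_eq_zero (Finset.mem_univ j) (if_neg hj)
    rw [hprod, mul_zero]
    exact mul_nonneg (clauseWeight_nonneg hl σ c) (sq_nonneg _)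

/-! ### `E[X₊] ≥ c E[X]` -/

/-- For a fixed assignment `σ` and `m ≥ 1`: `Σ_Φ 1[2 S(σ,Φ) ≥ km] W_λ(σ,Φ) ≥ c · U^m`, where
`U = n^k((1+λ)^k - 1) = Σ_c clauseWeight` and `c = v₀/(4(k² + 3v₀))`,
`v₀ = k²λ^k/((1+λ)^k - 1)`: the tilted law `clauseWeight/U` makes the clauses i.i.d. with
`H = 2s - k` centred (balance equation), `|H| ≤ k`, tilted variance `≥ v₀`, and
`Literature.Probability.Moments.sum_prod_ite_sum_nonneg_ge` applies.
[cite: AchlioptasPeres2004, Lemma 7 and §8 (arXiv:cs/0305009 pp. 15–17), positive-probability form] -/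
theorem sum_ite_assignmentWeight_ge (hn : 1 ≤ n) (hk : 1 ≤ k) {lam : ℝ} (hl : 0 < lam)
    (hbal : (1 + lam) ^ (k - 1) * (1 - lam) = 1) (σ : Fin n → Bool) (hm : 1 ≤ m) :
    (k : ℝ) ^ 2 * lam ^ k / ((1 + lam) ^ k - 1) /
        (4 * ((k : ℝ) ^ 2 + 3 * ((k : ℝ) ^ 2 * lam ^ k / ((1 + lam) ^ k - 1)))) *
        ((n : ℝ) ^ k * ((1 + lam) ^ k - 1)) ^ m ≤
      ∑ Φ : Fin m → Fin k → Fin n × Bool,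
        (if k * m ≤ 2 * totalSat σ Φ then assignmentWeight lam σ Φ else 0) := by
  -- the tilted probability weight on clauses
  set U : ℝ := (n : ℝ) ^ k * ((1 + lam) ^ k - 1) with hU
  have hgrow : 0 < (1 + lam) ^ k - 1 := by
    have : (1 : ℝ) < (1 + lam) ^ k := one_lt_pow₀ (by linarith) (by omega)
    linarith
  have hnpos : (0 : ℝ) < n := by exact_mod_cast hn
  have hU0 : 0 < U := by positivity
  set p : (Fin k → Fin n × Bool) → ℝ := fun c => clauseWeight lam σ c / U with hp
  set Y : (Fin k → Fin n × Bool) → ℝ := fun c => 2 * (satCount σ c : ℝ) - k with hY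
  have hp0 : ∀ c, 0 ≤ p c := fun c => div_nonneg (clauseWeight_nonneg hl.le σ c) hU0.le
  have hp1 : ∑ c, p c = 1 := by
    simp only [hp]
    rw [← Finset.sum_div, sum_clauseWeight, ← hU, div_self hU0.ne']
  have hY1 : ∑ c, p c * Y c = 0 := by
    simp only [hp, hY]
    have e : ∀ c : Fin k → Fin n × Bool, clauseWeight lam σ c / U * (2 * (satCount σ c : ℝ) - k) =
        (clauseWeight lam σ c * (2 * (satCount σ c : ℝ) - k)) / U := fun c => by ring
    simp only [e]
    rw [← Finset.sum_div, sum_clauseWeight_mul_sub_eq_zero hk hbal, zero_div]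
  have hK : ∀ c, |Y c| ≤ k := by
    intro c
    simp only [hY]
    have h0 : (0 : ℝ) ≤ satCount σ c := Nat.cast_nonneg _
    have h1 : (satCount σ c : ℝ) ≤ k := by exact_mod_cast satCount_le σ c
    rw [abs_le]; constructor <;> linarith
  -- tilted variance, bounded below by `v₀`
  set v : ℝ := ∑ c, p c * Y c ^ 2 with hv
  set v₀ : ℝ := (k : ℝ) ^ 2 * lam ^ k / ((1 + lam) ^ k - 1) with hv₀
  have hkpos : (0 : ℝ) < k := by exact_mod_cast hk
  have hv₀pos : 0 < v₀ := by positivity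
  have hvge : v₀ ≤ v := by
    simp only [hv, hp, hY, hv₀]
    have e : ∀ c : Fin k → Fin n × Bool,
        clauseWeight lam σ c / U * (2 * (satCount σ c : ℝ) - k) ^ 2 =
        (clauseWeight lam σ c * (2 * (satCount σ c : ℝ) - k) ^ 2) / U := fun c => by ring
    simp only [e]
    rw [← Finset.sum_div, le_div_iff₀ hU0, hU]
    calc (k : ℝ) ^ 2 * lam ^ k / ((1 + lam) ^ k - 1) * ((n : ℝ) ^ k * ((1 + lam) ^ k - 1))
        = (k : ℝ) ^ 2 * ((n : ℝ) * lam) ^ k := by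
          rw [mul_pow]; field_simp
      _ ≤ _ := sum_clauseWeight_mul_sub_sq_ge hl.le σ
  have hvpos : 0 < v := lt_of_lt_of_le hv₀pos hvge
  -- the fourth-moment sign bound under the tilted law
  have main := Literature.Probability.Moments.sum_prod_ite_sum_nonneg_ge hp0 hp1 hY1 hvpos rfl hK hm
  -- monotonicity of `v ↦ v/(4(K²+3v))`
  have hmono : v₀ / (4 * ((k : ℝ) ^ 2 + 3 * v₀)) ≤ v / (4 * ((k : ℝ) ^ 2 + 3 * v)) := by
    rw [div_le_div_iff₀ (by positivity) (by positivity)]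
    nlinarith [sq_nonneg (k : ℝ)]
  -- rewrite the target sum through the tilted law: `W_λ = U^m ∏ p`, `1[km ≤ 2S] = 1[0 ≤ Σ Y]`
  have hrew : ∑ Φ : Fin m → Fin k → Fin n × Bool,
      (if k * m ≤ 2 * totalSat σ Φ then assignmentWeight lam σ Φ else 0) =
      U ^ m * ∑ Φ : Fin m → Fin k → Fin n × Bool, (∏ i, p (Φ i)) *
        (if 0 ≤ ∑ i, Y (Φ i) then 1 else 0) := by
    rw [Finset.mul_sum]
    refine Finset.sum_congr rfl fun Φ _ => ?_
    have hW : assignmentWeight lam σ Φ = U ^ m * ∏ i, p (Φ i) := by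
      simp only [hp, assignmentWeight, Finset.prod_div_distrib, Finset.prod_const,
        Finset.card_univ, Fintype.card_fin]
      rw [mul_div_cancel₀ _ (pow_ne_zero m hU0.ne')]
    have hcond : (k * m ≤ 2 * totalSat σ Φ) ↔ (0 ≤ ∑ i, Y (Φ i)) := by
      simp only [hY, Finset.sum_sub_distrib, Finset.sum_const, Finset.card_univ, Fintype.card_fin,
        nsmul_eq_mul, ← Finset.mul_sum, totalSat]
      constructor
      · intro h
        have : ((k * m : ℕ) : ℝ) ≤ ((2 * ∑ i, satCount σ (Φ i) : ℕ) : ℝ) := by exact_mod_cast h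
        push_cast at this
        linarith
      · intro h
        have : ((k * m : ℕ) : ℝ) ≤ ((2 * ∑ i, satCount σ (Φ i) : ℕ) : ℝ) := by
          push_cast; linarith
        exact_mod_cast this
    by_cases hc : k * m ≤ 2 * totalSat σ Φ
    · rw [if_pos hc, if_pos (hcond.mp hc), hW]; ring
    · rw [if_neg hc, if_neg (fun h => hc (hcond.mpr h))]; ring
  rw [hrew, mul_comm]
  exact mul_le_mul_of_nonneg_left (hmono.trans main) (pow_nonneg hU0.le m)

/-- **Achlioptas–Peres, Lemma 7 (positive-probability form)**: for `k ≥ 1`, `λ > 0` satisfying the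
balance equation `(1+λ)^{k-1}(1-λ) = 1` (AP (47) with `λ = γ² = 1 - ε₀`), there is `c = c(k,λ) > 0`
such that `Σ_Φ X₊(Φ) ≥ c · Σ_Φ X(Φ)` for every `n ≥ 1` and every `m` (AP prove
`E[X₊]/E[X] → 1/2` by the CLT; the second-moment argument only uses a positive constant, cf.
AP (51): `3 E[X₊]² > E[X]²`). [cite: AchlioptasPeres2004, Lemma 7 (arXiv:cs/0305009 p. 15)] -/
theorem exists_sum_balancedCount_ge (hk : 1 ≤ k) {lam : ℝ} (hl : 0 < lam)
    (hbal : (1 + lam) ^ (k - 1) * (1 - lam) = 1) :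
    ∃ c : ℝ, 0 < c ∧ ∀ n m : ℕ, 1 ≤ n →
      c * ∑ Φ : Fin m → Fin k → Fin n × Bool, weightedCount lam Φ ≤
        ∑ Φ : Fin m → Fin k → Fin n × Bool, balancedCount lam Φ := by
  set v₀ : ℝ := (k : ℝ) ^ 2 * lam ^ k / ((1 + lam) ^ k - 1) with hv₀
  have hgrow : 0 < (1 + lam) ^ k - 1 := by
    have : (1 : ℝ) < (1 + lam) ^ k := one_lt_pow₀ (by linarith) (by omega)
    linarith
  have hkpos : (0 : ℝ) < k := by exact_mod_cast hk
  have hv₀pos : 0 < v₀ := by positivity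
  refine ⟨v₀ / (4 * ((k : ℝ) ^ 2 + 3 * v₀)), by positivity, ?_⟩
  intro n m hn
  have hc1 : v₀ / (4 * ((k : ℝ) ^ 2 + 3 * v₀)) ≤ 1 := by
    rw [div_le_one (by positivity)]; nlinarith [sq_nonneg (k : ℝ)]
  rcases Nat.eq_zero_or_pos m with rfl | hm
  · -- `m = 0`: `X₊ = X` and `c ≤ 1`
    have hX : ∀ Φ : Fin 0 → Fin k → Fin n × Bool, balancedCount lam Φ = weightedCount lam Φ := by
      intro Φ
      unfold balancedCount weightedCount
      refine Finset.sum_congr rfl fun σ _ => ?_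
      rw [if_pos (by simp)]
    simp only [hX]
    have h0 : 0 ≤ ∑ Φ : Fin 0 → Fin k → Fin n × Bool, weightedCount lam Φ :=
      Finset.sum_nonneg fun Φ _ => weightedCount_nonneg hl.le Φ
    nlinarith
  · -- `m ≥ 1`: sum the per-`σ` bound over `σ`
    rw [sum_weightedCount]
    unfold balancedCount
    rw [Finset.sum_comm]
    have hσ : ∀ σ : Fin n → Bool, v₀ / (4 * ((k : ℝ) ^ 2 + 3 * v₀)) *
        ((n : ℝ) ^ k * ((1 + lam) ^ k - 1)) ^ m ≤
        ∑ Φ : Fin m → Fin k → Fin n × Bool,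
          (if k * m ≤ 2 * totalSat σ Φ then assignmentWeight lam σ Φ else 0) :=
      fun σ => sum_ite_assignmentWeight_ge hn hk hl hbal σ hm
    have hsum := Finset.sum_le_sum fun σ (_ : σ ∈ (univ : Finset (Fin n → Bool))) => hσ σ
    rw [Finset.sum_const, Finset.card_univ, Fintype.card_fun, Fintype.card_bool, Fintype.card_fin,
      nsmul_eq_mul] at hsum
    push_cast at hsum
    linarith

end RandomKSat

end Literature.Computability.Complexity

end
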